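import Summits.ResolutionOfSingularities.ResolutionOfSingularities.Theorems.HomologicalConductorNoZenoSplitExcCount
import Summits.ResolutionOfSingularities.ResolutionOfSingularities.Theorems.HomologicalConductorNoZenoExcCurvesBaseChange
import Summits.ResolutionOfSingularities.ResolutionOfSingularities.Theorems.HomologicalConductorNoZenoPullbackResidueField
import Summits.ResolutionOfSingularities.ResolutionOfSingularities.Theorems.HomologicalConductorNoZenoSplitFieldFibreCount
import HarnessLib

/-!
# Crux `NoZenoR` / `NoZeno` (stmt-ResolutionOfSingularities-19943 / -16483), β2 descent, `stub_L1wCore` (F1) route,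
# BC-2 (assembly): **the split count `N^s` is invariant under a finite base change with separable residue field**

OURS (cell res-hironaka, chain W4.4; stub worker res-L0-w44-stub-2 g12; brick DAG `L1W-PREP-v2.md` 95253e48ec58b05c
§2.1 D3/D5, brick BC-2 = BC-2a (`…ExcCurvesBaseChange`, `…PullbackResidueField`) + BC-2b (`…SplitFieldFibre(Count)`)).
Nothing here is a statement of the manuscript under review (Hironaka 2017); AI-written, weaker than expert review.

Setting: `π : X → Spec R` (`R` local), `g : Spec R_B → Spec R` FINITE with `g ⁻¹' {𝔪_R} = {𝔪_{R_B}}` and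
`κ(𝔪_{R_B}) / κ(𝔪_R)` finite separable (e.g. the local-étale splitting base `R_B = R[t]/(f)` of (F1)), and
`X_B := X ×_{Spec R} Spec R_B` with `σ = pullback.fst`, `π_B = pullback.snd`.

* `finrank_separableClosure_algebra_irrel` — the separable degree only depends on the structure map;
* `finsum_weight_eq_of_ringEquiv` — `Σ_{p ∈ Spec A} max 1 [κ(p)^s : K]` is invariant under `K`-compatible ring
  isomorphisms `A ≃ B`;
* `finite_of_residueFieldCongr`, `isSeparable_of_residueFieldCongr` — bookkeeping along `residueFieldCongr`;
* `snd_eq_closedPoint_of_fst`, `preimage_fst_singleton_eq` — the fibre of `σ` over a point `η` of the closed fibre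
  is the fibre of `X_B → X × Spec R_B` over `(η, 𝔪_{R_B})`;
* `finsum_splitWeight_specTensorTo` (triplet form), **`finsum_splitWeight_preimage_fst`** —
  `Σ_{ζ ∈ σ⁻¹ η} splitWeight π_B ζ = splitWeight π η` whenever
  `[κ(η)^s : κ(𝔪_R)] < ∞` (the weight of `η` is honest): the fibre is `Spec (κ(η) ⊗_κ κ_B)`
  (`bijOn_specTensorTo`, `exists_tensorIso`), the weight of `ζ` is computed in the tensor product
  (`finrank_separableClosure_residueField_specTensorTo`) and the weights of `Spec (κ_B ⊗_κ κ(η))` add up to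
  `[κ(η)^s : κ]` (`SplitFieldFibre.finsum_finrank_separableClosure_residueField_tensorProduct`);
* **`splitExcCount_pullback_snd`** — `splitExcCount π_B = splitExcCount π` when `π` has finitely many integral
  exceptional curves, all of finite (honest) split weight: D3's count line «`N^s` does not change upstairs» and D5's
  «`splitExcCount π' = splitExcCount (π')_B`» of the (F1) descent.
-/

noncomputable section

-- single-problem summit: the doubled namespace component `ResolutionOfSingularities` is forced
set_option linter.dupNamespace false

namespace Summit.ResolutionOfSingularities.ResolutionOfSingularities.Theorems.NoZeno.ExcCount

open CategoryTheory CategoryTheory.Limits AlgebraicGeometry AlgebraicGeometry.Scheme.Pullback IsLocalRing TensorProduct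
open Literature.AlgebraicGeometry.Resolution

/-! ## Algebra: the separable degree only depends on the structure map; transport along ring isomorphisms -/

section Algebra

/-- Two `K`-algebra structures on a field `E` with the same structure map have the same separable degree.
[folklore] -/
theorem finrank_separableClosure_algebra_irrel {K E : Type*} [Field K] [Field E] (i₁ i₂ : Algebra K E)
    (h : ∀ k, (letI := i₁; algebraMap K E k) = (letI := i₂; algebraMap K E k)) :
    (letI := i₁; Module.finrank K (separableClosure K E)) = (letI := i₂; Module.finrank K (separableClosure K E)) := by
  obtain rfl : i₁ = i₂ := Algebra.algebra_ext _ _ h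
  rfl

/-- **`Σ_{p ∈ Spec A} max 1 [κ(p)^s : K]` is invariant under a ring isomorphism `E : A ≃ B` compatible with the
structure maps `i_A : K → A`, `i_B : K → B`** (`κ(p) = p.ResidueField` with the `K`-structure through `i_A`, resp.
`i_B`). [folklore] -/
theorem finsum_weight_eq_of_ringEquiv {K A B : Type*} [Field K] [CommRing A] [CommRing B] (iA : K →+* A)
    (iB : K →+* B) (E : A ≃+* B) (hE : ∀ k, E (iA k) = iB k) :
    ∑ᶠ p : PrimeSpectrum A, (letI := ((algebraMap A p.asIdeal.ResidueField).comp iA).toAlgebra;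
        max 1 (Module.finrank K (separableClosure K p.asIdeal.ResidueField))) =
      ∑ᶠ q : PrimeSpectrum B, (letI := ((algebraMap B q.asIdeal.ResidueField).comp iB).toAlgebra;
        max 1 (Module.finrank K (separableClosure K q.asIdeal.ResidueField))) := by
  refine finsum_eq_of_bijective (PrimeSpectrum.comapEquiv E) (PrimeSpectrum.comapEquiv E).bijective fun p => ?_
  -- `q := comapEquiv E p = comap E⁻¹ p`, and `p = q.comap E`
  set q : PrimeSpectrum B := PrimeSpectrum.comapEquiv E p with hq
  have hpq : p.asIdeal = q.asIdeal.comap E.toRingHom := by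
    have : p = PrimeSpectrum.comap E.toRingHom q := ((PrimeSpectrum.comapEquiv E).symm_apply_apply p).symm
    conv_lhs => rw [this]
    rfl
  -- the residue fields are isomorphic, compatibly with `i_A`, `i_B`
  have hbij := (RingHom.surjectiveOnStalks_of_surjective E.surjective).residueFieldMap_bijective
    p.asIdeal q.asIdeal hpq
  let e₁ : p.asIdeal.ResidueField ≃+* q.asIdeal.ResidueField := RingEquiv.ofBijective _ hbij
  have h := finrank_separableClosure_eq_of_ringEquiv ((algebraMap A p.asIdeal.ResidueField).comp iA)
    ((algebraMap B q.asIdeal.ResidueField).comp iB) (RingEquiv.refl K) e₁ fun k => by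
      change Ideal.ResidueField.map p.asIdeal q.asIdeal E.toRingHom hpq (algebraMap A _ (iA k)) =
        algebraMap B _ (iB k)
      rw [Ideal.ResidueField.map_algebraMap]
      exact congrArg _ (hE k)
  exact congrArg (max 1) h

end Algebra

/-! ## Bookkeeping along `residueFieldCongr` -/

section Congr

variable {Y S : Scheme.{0}} (g : Y ⟶ S) (y : Y) {s : S} (h : g.base y = s)

include h in
/-- Finiteness of `κ(y)/κ(g y)` transported to the structure map `κ(s) ≅ κ(g y) → κ(y)`. [folklore] -/
theorem finite_of_residueFieldCongr
    (hfin : letI := (g.residueFieldMap y).hom.toAlgebra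
      Module.Finite (S.residueField (g.base y)) (Y.residueField y)) :
    letI := ((S.residueFieldCongr h).inv ≫ g.residueFieldMap y).hom.toAlgebra
    Module.Finite (S.residueField s) (Y.residueField y) := by
  subst h
  exact hfin

include h in
/-- Separability of `κ(y)/κ(g y)` transported to the structure map `κ(s) ≅ κ(g y) → κ(y)`. [folklore] -/
theorem isSeparable_of_residueFieldCongr
    (hsep : letI := (g.residueFieldMap y).hom.toAlgebra
      Algebra.IsSeparable (S.residueField (g.base y)) (Y.residueField y)) :
    letI := ((S.residueFieldCongr h).inv ≫ g.residueFieldMap y).hom.toAlgebra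
    Algebra.IsSeparable (S.residueField s) (Y.residueField y) := by
  subst h
  exact hsep

end Congr

/-! ## The fibre of `σ : X_B → X` over a point of the closed fibre -/

section Fibre

variable {R RB : Type} [CommRing R] [IsLocalRing R] [CommRing RB] [IsLocalRing RB]
  {X : Scheme.{0}} (π : X ⟶ Spec (.of R)) (g : Spec (.of RB) ⟶ Spec (.of R))
  (hg : g.base ⁻¹' {closedPoint R} = {closedPoint RB})

include hg in
/-- `g 𝔪_{R_B} = 𝔪_R`. [folklore] -/
theorem base_closedPoint_eq : g.base (closedPoint RB) = closedPoint R := by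
  have : closedPoint RB ∈ g.base ⁻¹' {closedPoint R} := by rw [hg]; rfl
  exact this

include hg in
/-- A point of `X_B` over a point `η` of the closed fibre of `π` lies over the closed point of `Spec R_B`. [this work] -/
theorem snd_eq_closedPoint_of_fst (ζ : ↑(pullback π g)) (hζ : π.base (pullback.fst π g ζ) = closedPoint R) :
    pullback.snd π g ζ = closedPoint RB := by
  have hcond : π.base (pullback.fst π g ζ) = g.base (pullback.snd π g ζ) := by
    change (pullback.fst π g ≫ π).base ζ = (pullback.snd π g ≫ g).base ζ
    rw [pullback.condition]
  have h1 : g.base (pullback.snd π g ζ) = closedPoint R := by rw [← hcond, hζ]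
  have h2 : pullback.snd π g ζ ∈ g.base ⁻¹' {closedPoint R} := h1
  rw [hg] at h2
  exact h2

include hg in
/-- The fibre of `σ = pullback.fst` over `η` in the closed fibre is the fibre of `X_B → X × Spec R_B` over
`(η, 𝔪_{R_B})`. [this work] -/
theorem preimage_fst_singleton_eq (η : X) (hη : π.base η = closedPoint R) :
    (pullback.fst π g).base ⁻¹' {η} = {ζ | pullback.fst π g ζ = η ∧ pullback.snd π g ζ = closedPoint RB} := by
  ext ζ
  constructor
  · intro h
    have h1 : pullback.fst π g ζ = η := h
    exact ⟨h1, snd_eq_closedPoint_of_fst π g hg ζ (by rw [h1, hη])⟩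
  · intro h
    exact h.1

omit [IsLocalRing R] [IsLocalRing RB] in
/-- **The split weights over a triplet add up** (generic form): for a triplet `T = (x, y, s)` over `π` and `g`
with `κ(y)/κ(s)` finite separable and `[κ(x)^s : κ(s)] < ∞` (structure maps of the triplet), the split weights of
the points `T.SpecTensorTo p`, `p ∈ Spec T.tensor`, add up to `[κ(x)^s : κ(s)]`: the weight of `ζ_p` is computed in
`T.tensor` (`finrank_separableClosure_residueField_specTensorTo`), `T.tensor ≅ κ(x) ⊗ κ(y) ≅ κ(y) ⊗ κ(x)`
(`exists_tensorIso`), and the weights of `Spec (κ(y) ⊗_{κ(s)} κ(x))` add up to `[κ(x)^s : κ(s)]`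
(`SplitFieldFibre.finsum_finrank_separableClosure_residueField_tensorProduct`). [this work] -/
theorem finsum_splitWeight_specTensorTo (T : Triplet π g)
    (hfin : letI := (((Spec (.of R)).residueFieldCongr T.hy).inv ≫ g.residueFieldMap T.y).hom.toAlgebra
      Module.Finite ((Spec (.of R)).residueField T.s) ((Spec (.of RB)).residueField T.y))
    (hsep : letI := (((Spec (.of R)).residueFieldCongr T.hy).inv ≫ g.residueFieldMap T.y).hom.toAlgebra
      Algebra.IsSeparable ((Spec (.of R)).residueField T.s) ((Spec (.of RB)).residueField T.y))
    (hFW : letI := (((Spec (.of R)).residueFieldCongr T.hx).inv ≫ π.residueFieldMap T.x).hom.toAlgebra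
      FiniteDimensional ((Spec (.of R)).residueField T.s)
        (separableClosure ((Spec (.of R)).residueField T.s) (X.residueField T.x))) :
    ∑ᶠ p : Spec T.tensor, splitWeight (pullback.snd π g) (T.SpecTensorTo p) =
      (letI := (((Spec (.of R)).residueFieldCongr T.hx).inv ≫ π.residueFieldMap T.x).hom.toAlgebra;
        Module.finrank ((Spec (.of R)).residueField T.s)
          (separableClosure ((Spec (.of R)).residueField T.s) (X.residueField T.x))) := by
  letI iF : Algebra ((Spec (.of R)).residueField T.s) (X.residueField T.x) :=
    (((Spec (.of R)).residueFieldCongr T.hx).inv ≫ π.residueFieldMap T.x).hom.toAlgebra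
  letI iK : Algebra ((Spec (.of R)).residueField T.s) ((Spec (.of RB)).residueField T.y) :=
    (((Spec (.of R)).residueFieldCongr T.hy).inv ≫ g.residueFieldMap T.y).hom.toAlgebra
  haveI : Module.Finite ((Spec (.of R)).residueField T.s) ((Spec (.of RB)).residueField T.y) := hfin
  haveI : Algebra.IsSeparable ((Spec (.of R)).residueField T.s) ((Spec (.of RB)).residueField T.y) := hsep
  haveI : FiniteDimensional ((Spec (.of R)).residueField T.s)
      (separableClosure ((Spec (.of R)).residueField T.s) (X.residueField T.x)) := hFW
  have hmax : ∀ p : Spec T.tensor, p.asIdeal.IsMaximal := isMaximal_of_finite T hfin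
  -- (1) the weight of `ζ_p` is computed in `T.tensor`
  have hpt : ∀ p : Spec T.tensor, splitWeight (pullback.snd π g) (T.SpecTensorTo p) =
      (letI := ((algebraMap T.tensor p.asIdeal.ResidueField).comp T.tensorInr.hom).toAlgebra;
        max 1 (Module.finrank ((Spec (.of RB)).residueField T.y)
          (separableClosure ((Spec (.of RB)).residueField T.y) p.asIdeal.ResidueField))) := by
    intro p
    haveI := hmax p
    unfold splitWeight
    rw [finrank_separableClosure_residueField_specTensorTo T p]
  rw [finsum_congr hpt]
  -- (2) transport along `T.tensor ≅ κ(x) ⊗ κ(y) ≅ κ(y) ⊗ κ(x)`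
  obtain ⟨e, -, he⟩ := exists_tensorIso T
  let E : T.tensor ≃+* ((Spec (.of RB)).residueField T.y) ⊗[(Spec (.of R)).residueField T.s]
      (X.residueField T.x) :=
    e.commRingCatIsoToRingEquiv.trans (Algebra.TensorProduct.comm _ _ _).toRingEquiv
  have hE : ∀ k, E (T.tensorInr.hom k) = algebraMap ((Spec (.of RB)).residueField T.y)
      (((Spec (.of RB)).residueField T.y) ⊗[(Spec (.of R)).residueField T.s] (X.residueField T.x)) k := by
    intro k
    have h1 : e.hom.hom (T.tensorInr.hom k) = (1 : X.residueField T.x) ⊗ₜ k := by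
      have := congrArg (fun φ => φ.hom k) he
      simp only [CommRingCat.hom_comp, RingHom.comp_apply, CommRingCat.hom_ofHom] at this
      exact this
    change (Algebra.TensorProduct.comm _ _ _) (e.hom.hom (T.tensorInr.hom k)) = k ⊗ₜ 1
    rw [h1, Algebra.TensorProduct.comm_tmul]
  refine Eq.trans (rfl : _ = ∑ᶠ p : PrimeSpectrum T.tensor, _)
    ((finsum_weight_eq_of_ringEquiv T.tensorInr.hom _ E hE).trans ?_)
  -- (3) the weights of `Spec (κ(y) ⊗ κ(x))` add up to `[κ(x)^s : κ(s)]` (all of them honest, `≥ 1`)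
  have hq : ∀ q : PrimeSpectrum (((Spec (.of RB)).residueField T.y) ⊗[(Spec (.of R)).residueField T.s]
      (X.residueField T.x)),
      (letI := ((algebraMap (((Spec (.of RB)).residueField T.y) ⊗[(Spec (.of R)).residueField T.s]
          (X.residueField T.x)) q.asIdeal.ResidueField).comp (algebraMap ((Spec (.of RB)).residueField T.y)
          (((Spec (.of RB)).residueField T.y) ⊗[(Spec (.of R)).residueField T.s] (X.residueField T.x)))).toAlgebra;
        max 1 (Module.finrank ((Spec (.of RB)).residueField T.y)
          (separableClosure ((Spec (.of RB)).residueField T.y) q.asIdeal.ResidueField))) =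
      Module.finrank ((Spec (.of RB)).residueField T.y)
        (separableClosure ((Spec (.of RB)).residueField T.y) q.asIdeal.ResidueField) := by
    intro q
    have hirr := finrank_separableClosure_algebra_irrel
      ((algebraMap (((Spec (.of RB)).residueField T.y) ⊗[(Spec (.of R)).residueField T.s]
          (X.residueField T.x)) q.asIdeal.ResidueField).comp (algebraMap ((Spec (.of RB)).residueField T.y)
          (((Spec (.of RB)).residueField T.y) ⊗[(Spec (.of R)).residueField T.s] (X.residueField T.x)))).toAlgebra
      (inferInstance : Algebra ((Spec (.of RB)).residueField T.y) q.asIdeal.ResidueField)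
      (fun k => (IsScalarTower.algebraMap_apply ((Spec (.of RB)).residueField T.y)
        (((Spec (.of RB)).residueField T.y) ⊗[(Spec (.of R)).residueField T.s] (X.residueField T.x))
        q.asIdeal.ResidueField k).symm)
    exact (congrArg (max 1) hirr).trans
      (max_eq_right (SplitFieldFibre.one_le_finrank_separableClosure_residueField_tensorProduct _ _ _ q))
  rw [finsum_congr hq, SplitFieldFibre.finsum_finrank_separableClosure_residueField_tensorProduct]

include hg in
/-- **The split weights over `η` add up to the split weight of `η`**: for `g : Spec R_B → Spec R` with
`g ⁻¹' {𝔪_R} = {𝔪_{R_B}}` and `κ(𝔪_{R_B})/κ(𝔪_R)` finite separable, and a point `η` of the closed fibre of `π` whose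
separable constant field `κ(η)^s` is finite over `κ(𝔪_R)`:
`Σ_{ζ ∈ σ⁻¹ η} splitWeight π_B ζ = splitWeight π η`. [this work] -/
theorem finsum_splitWeight_preimage_fst (η : X) (hη : π.base η = closedPoint R)
    (hfin : letI := (g.residueFieldMap (closedPoint RB)).hom.toAlgebra
      Module.Finite ((Spec (.of R)).residueField (g.base (closedPoint RB)))
        ((Spec (.of RB)).residueField (closedPoint RB)))
    (hsep : letI := (g.residueFieldMap (closedPoint RB)).hom.toAlgebra
      Algebra.IsSeparable ((Spec (.of R)).residueField (g.base (closedPoint RB)))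
        ((Spec (.of RB)).residueField (closedPoint RB)))
    (hFW : letI := (π.residueFieldMap η).hom.toAlgebra
      FiniteDimensional ((Spec (.of R)).residueField (π.base η))
        (separableClosure ((Spec (.of R)).residueField (π.base η)) (X.residueField η))) :
    ∑ᶠ ζ ∈ (pullback.fst π g).base ⁻¹' {η}, splitWeight (pullback.snd π g) ζ = splitWeight π η := by
  have hy : g.base (closedPoint RB) = π.base η := (base_closedPoint_eq g hg).trans hη.symm
  -- the two algebra structures `κ(π η) → κ(η)`: through `π.residueFieldMap η`, and through the triplet's
  -- `(residueFieldCongr rfl).inv ≫ π.residueFieldMap η` — same structure map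
  have halg : ∀ k, (letI := (((Spec (.of R)).residueFieldCongr (rfl : π.base η = π.base η)).inv ≫
        π.residueFieldMap η).hom.toAlgebra; algebraMap ((Spec (.of R)).residueField (π.base η))
          (X.residueField η) k) =
      (letI := (π.residueFieldMap η).hom.toAlgebra;
        algebraMap ((Spec (.of R)).residueField (π.base η)) (X.residueField η) k) := by
    intro k
    change (((Spec (.of R)).residueFieldCongr (rfl : π.base η = π.base η)).inv ≫ π.residueFieldMap η).hom k =
      (π.residueFieldMap η).hom k
    simp [Scheme.residueFieldCongr_refl]
  have hFW' : letI := (((Spec (.of R)).residueFieldCongr (rfl : π.base η = π.base η)).inv ≫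
        π.residueFieldMap η).hom.toAlgebra
      FiniteDimensional ((Spec (.of R)).residueField (π.base η))
        (separableClosure ((Spec (.of R)).residueField (π.base η)) (X.residueField η)) := by
    obtain h := Algebra.algebra_ext _ _ halg
    rw [h]
    exact hFW
  -- (1) the fibre is the bijective image of `Spec T.tensor`, `T = (η, 𝔪_{R_B}, π η)`
  rw [preimage_fst_singleton_eq π g hg η hη,
    ← finsum_mem_eq_of_bijOn _ (bijOn_specTensorTo (⟨η, closedPoint RB, π.base η, rfl, hy⟩ : Triplet π g))
      (fun p _ => rfl), finsum_mem_univ,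
    finsum_splitWeight_specTensorTo π g ⟨η, closedPoint RB, π.base η, rfl, hy⟩
      (finite_of_residueFieldCongr g (closedPoint RB) hy hfin)
      (isSeparable_of_residueFieldCongr g (closedPoint RB) hy hsep) hFW']
  -- (2) the weight of `η` is honest
  change (letI := (((Spec (.of R)).residueFieldCongr (rfl : π.base η = π.base η)).inv ≫
        π.residueFieldMap η).hom.toAlgebra;
      Module.finrank ((Spec (.of R)).residueField (π.base η))
        (separableClosure ((Spec (.of R)).residueField (π.base η)) (X.residueField η))) = splitWeight π η
  rw [finrank_separableClosure_algebra_irrel _ _ halg]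
  letI := (π.residueFieldMap η).hom.toAlgebra
  haveI : FiniteDimensional ((Spec (.of R)).residueField (π.base η))
      (separableClosure ((Spec (.of R)).residueField (π.base η)) (X.residueField η)) := hFW
  unfold splitWeight
  exact (max_eq_right Module.finrank_pos).symm

end Fibre

/-! ## The count -/

section Count

variable {R RB : Type} [CommRing R] [IsLocalRing R] [CommRing RB] [IsLocalRing RB]
  {X : Scheme.{0}} (π : X ⟶ Spec (.of R)) (g : Spec (.of RB) ⟶ Spec (.of R))
  (hg : g.base ⁻¹' {closedPoint R} = {closedPoint RB})

include hg in
/-- **BC-2: `N^s` is invariant under a finite base change with separable residue field.** For `g : Spec R_B → Spec R`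
finite with `g ⁻¹' {𝔪_R} = {𝔪_{R_B}}` and `κ(𝔪_{R_B})/κ(𝔪_R)` finite separable, and `π : X → Spec R` with finitely many
integral exceptional curves, each of finite (honest) split weight:
`splitExcCount (pullback.snd π g) = splitExcCount π`. [this work] -/
theorem splitExcCount_pullback_snd [IsFinite g]
    (hfin : letI := (g.residueFieldMap (closedPoint RB)).hom.toAlgebra
      Module.Finite ((Spec (.of R)).residueField (g.base (closedPoint RB)))
        ((Spec (.of RB)).residueField (closedPoint RB)))
    (hsep : letI := (g.residueFieldMap (closedPoint RB)).hom.toAlgebra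
      Algebra.IsSeparable ((Spec (.of R)).residueField (g.base (closedPoint RB)))
        ((Spec (.of RB)).residueField (closedPoint RB)))
    (hfinπ : (excCurvePoints π).Finite)
    (hFW : ∀ η ∈ excCurvePoints π, letI := (π.residueFieldMap η).hom.toAlgebra
      FiniteDimensional ((Spec (.of R)).residueField (π.base η))
        (separableClosure ((Spec (.of R)).residueField (π.base η)) (X.residueField η))) :
    splitExcCount (pullback.snd π g) = splitExcCount π := by
  unfold splitExcCount
  rw [excCurvePoints_pullback_snd π g hg, ← Set.biUnion_preimage_singleton]
  rw [finsum_mem_biUnion ?_ hfinπ fun η _ => (pullback.fst π g).finite_preimage_singleton η]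
  · refine finsum_mem_congr rfl fun η hη => ?_
    exact finsum_splitWeight_preimage_fst π g hg η hη.1 hfin hsep (hFW η hη)
  · intro η _ η' _ hne
    refine Set.disjoint_left.mpr fun ζ h1 h2 => hne ?_
    exact h1.symm.trans h2

include hg in
/-- Same, packaged with the finiteness of the exceptional curves upstairs. [this work] -/
theorem excCurvePoints_finite_and_splitExcCount_pullback_snd [IsFinite g]
    (hfin : letI := (g.residueFieldMap (closedPoint RB)).hom.toAlgebra
      Module.Finite ((Spec (.of R)).residueField (g.base (closedPoint RB)))
        ((Spec (.of RB)).residueField (closedPoint RB)))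
    (hsep : letI := (g.residueFieldMap (closedPoint RB)).hom.toAlgebra
      Algebra.IsSeparable ((Spec (.of R)).residueField (g.base (closedPoint RB)))
        ((Spec (.of RB)).residueField (closedPoint RB)))
    (hfinπ : (excCurvePoints π).Finite)
    (hFW : ∀ η ∈ excCurvePoints π, letI := (π.residueFieldMap η).hom.toAlgebra
      FiniteDimensional ((Spec (.of R)).residueField (π.base η))
        (separableClosure ((Spec (.of R)).residueField (π.base η)) (X.residueField η))) :
    (excCurvePoints (pullback.snd π g)).Finite ∧ splitExcCount (pullback.snd π g) = splitExcCount π :=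
  ⟨excCurvePoints_pullback_snd_finite π g hg hfinπ, splitExcCount_pullback_snd π g hg hfin hsep hfinπ hFW⟩

end Count

end Summit.ResolutionOfSingularities.ResolutionOfSingularities.Theorems.NoZeno.ExcCount

end
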